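import Literature.AlgebraicGeometry.Motives.MixedHodgeStructureCatInternalHomFunctor
import Literature.AlgebraicGeometry.Motives.MixedHodgeStructureCatGradedPolarizable
import HarnessLib

/-!
# Graded-polarizable mixed Hodge structures form a tensor subcategory of `MixedHodgeStructureCat`: `⊗`, `Hom`, duals, Tate twists

Layer `Literature/AlgebraicGeometry/Motives` (lane `lit-hodgefound`), continuing `Motives/MixedHodgeStructureCatGradedPolarizable` (the object property
`isGradedPolarizable` = Arapura's `MHS^p`: finite-dimensional and every `Gr^W_k` polarizable; closed under sub-objects, quotients, binary products,
containing the `ℚ(j)`), g45-#9 (`isGradedPolarizable_dual_iff`), g45-#13 ∕ #15 ∕ #16 (`tensorObj`, `ihomObj`, `tensorLeft`, `tensorRight`, `ihom`,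
`tensorIhomAdj`, `unitObj`) and g45-#10 (`dualFunctor`).  The tree proves, unbundled, that graded-polarizability is preserved by `⊗`
(`IsGradedPolarizable.tensor`, Deligne 1.1.12 with 2.1.15), internal `Hom` (`IsGradedPolarizable.hom`), duals and Tate twists.  Categorically — the
geometric MHS (Deligne, *Hodge III* 8.2: the MHS of algebraic varieties are graded-polarizable) form a full TENSOR subcategory:

* §1 closure of `isGradedPolarizable` under **`⊗`** (`isGradedPolarizable_tensorObj`), **internal `Hom`** (`isGradedPolarizable_ihomObj`), the unit, Tate twists
  (`isGradedPolarizable_tateTwist_obj_iff`), kernels, cokernels and images;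
* §2 the full subcategory **`GPSubcategory`** with its fully faithful inclusion **`gpToFin : GPSubcategory ⥤ FinSubcategory`**, its unit and Tate objects;
* §3 the induced functors **`gpTensorLeft X`, `gpTensorRight X`, `gpIhom X : GPSubcategory ⥤ GPSubcategory`**, **`gpDual : GPSubcategoryᵒᵖ ⥤ GPSubcategory`**,
  **`gpTateTwist j`** (lifts through `gpToFin`, with the comparison isomorphisms to the `FinSubcategory` functors), and
* §4 the adjunction **`gpTensorIhomAdj X : gpTensorRight X ⊣ gpIhom X`** (`− ⊗ X ⊣ Hom(X, −)` stays inside `MHS^p`).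

Everything is PROVED; no named fact, no instance, no notation.

Sources, verbatim (through the tree's files).  P. Deligne, *Théorie de Hodge II* (1971) [DeligneHodgeII1971], 1.1.12, 2.1.15, 2.3.  J. A. Carlson, *Extensions of mixed
Hodge structures* (1980) [Carlson1980], §2(a) (graded-polarizable MHS; closed under the usual operations).  D. Arapura, [Arapura2022] §1 (`MHS^p`).  E. Cattani et
al. (eds.), *Hodge Theory* (2014) [CattaniElZeinGriffithsLe2014], Def. 3.1.21, §3.2.2.7.  P. Deligne, J. S. Milne, *Tannakian categories* (1982) [DeligneMilne1982Tannakian],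
§1 Def. 1.6–(1.7) (tensor subcategories closed under `⊗`, `Hom`, `∨`).

## Main results

* §1 **`isGradedPolarizable_tensorObj`**, **`isGradedPolarizable_ihomObj`**, `isGradedPolarizable_unitObj`, **`isGradedPolarizable_tateTwist_obj_iff`**,
  `isGradedPolarizable_kernel`, `isGradedPolarizable_cokernel`, `isGradedPolarizable_image`.
* §2 `GPSubcategory`, **`gpToFin`** (`_obj_obj`, `_map_hom`, `_full`, `_faithful`), `gpUnitObj`, `gpTateObj`.
* §3 **`gpTensorLeft`**, **`gpTensorRight`**, **`gpIhom`**, **`gpDual`**, **`gpTateTwist`** (each with `_obj_obj`, `_map_hom` and a comparison iso `…CompGpToFinIso`).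
* §4 `gpCurryEquiv`, **`gpTensorIhomAdj`**, `gpIhom_isRightAdjoint`, `gpTensorRight_isLeftAdjoint`.

## References

* [DeligneHodgeII1971] P. Deligne, Théorie de Hodge II, Publ. Math. IHÉS 40 (1971), 1.1.12, 2.1.15, 2.3.
* [Carlson1980] J. A. Carlson, Extensions of mixed Hodge structures, Journées de géométrie algébrique d'Angers 1979 (1980), §2(a).
* [Arapura2022] D. Arapura, (as keyed in references.bib), §1.
* [CattaniElZeinGriffithsLe2014] E. Cattani et al. (eds.), Hodge Theory, Princeton Math. Notes 49 (2014), Def. 3.1.21, Ch. 3 §3.2.2.7.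
* [DeligneMilne1982Tannakian] P. Deligne, J. S. Milne, Tannakian categories, in LNM 900 (1982), §1 Def. 1.6–(1.7).

## Provenance

Lane `lit-hodgefound` (summit `HodgeConjecture`), seat `lit-hodgefound-p36` (literature-prover, generation 45, row g45-#20).
-/

noncomputable section

open CategoryTheory CategoryTheory.Limits Opposite

namespace Literature.AlgebraicGeometry.Motives

universe u

namespace MixedHodgeStructureCat

variable {X Y : MixedHodgeStructureCat.{u}} [Module.Finite ℚ X] [Module.Finite ℚ Y]

/-! ## §1 Closure of `isGradedPolarizable` under `⊗`, `Hom`, unit, Tate twists, kernels, cokernels, images -/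

/-- **`X ⊗ Y` is graded-polarizable** if `X` and `Y` are (every `Gr^W_n(X ⊗ Y) ≅ ⊕ Gr^W_i X ⊗ Gr^W_j Y` is polarizable; the tree's `IsGradedPolarizable.tensor`).
[cite: DeligneHodgeII1971, 1.1.12 and 2.1.15] [cite: Carlson1980, §2(a)] -/
theorem isGradedPolarizable_tensorObj (hX : isGradedPolarizable X) (hY : isGradedPolarizable Y) : isGradedPolarizable (tensorObj X Y) :=
  ⟨finite_tensorObj X Y, hX.2.tensor hY.2⟩

/-- **`Hom(X, Y)` is graded-polarizable** if `X` and `Y` are (`Hom(X, Y) ≅ X^∨ ⊗ Y`; the tree's `IsGradedPolarizable.hom`). [cite: DeligneHodgeII1971, 1.1.12 and 2.1.15]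
[cite: Carlson1980, §2(a)] -/
theorem isGradedPolarizable_ihomObj (hX : isGradedPolarizable X) (hY : isGradedPolarizable Y) : isGradedPolarizable (ihomObj X Y) :=
  ⟨finite_ihomObj X Y, hX.2.hom hY.2⟩

/-- The unit `ℚ(0)` is graded-polarizable. [cite: DeligneHodgeII1971, 2.1.15] -/
theorem isGradedPolarizable_unitObj : isGradedPolarizable unitObj.{u} := isGradedPolarizable_tateObj 0

variable (X) in
/-- `X(j)` is graded-polarizable iff `X` is. [cite: DeligneHodgeII1971, 2.1.15] [cite: Carlson1980, §2(a)] -/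
theorem isGradedPolarizable_tateTwist_obj_iff (j : ℤ) : isGradedPolarizable ((tateTwist j).obj X) ↔ isGradedPolarizable X :=
  ⟨fun h => ⟨‹Module.Finite ℚ X›, (MixedHodgeStructure.isGradedPolarizable_tateTwist_iff X.str j).1 h.2⟩,
    fun h => ⟨‹Module.Finite ℚ X›, (MixedHodgeStructure.isGradedPolarizable_tateTwist_iff X.str j).2 h.2⟩⟩

/-- Kernels of morphisms out of graded-polarizable objects are graded-polarizable. [cite: Carlson1980, §2(a)] [cite: Arapura2022, §1] -/
theorem isGradedPolarizable_kernel {A B : MixedHodgeStructureCat.{u}} (f : A ⟶ B) (hA : isGradedPolarizable A) : isGradedPolarizable (kernel f) :=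
  isGradedPolarizable.prop_of_mono (kernel.ι f) hA

/-- Cokernels of morphisms into graded-polarizable objects are graded-polarizable. [cite: Carlson1980, §2(a)] [cite: Arapura2022, §1] -/
theorem isGradedPolarizable_cokernel {A B : MixedHodgeStructureCat.{u}} (f : A ⟶ B) (hB : isGradedPolarizable B) : isGradedPolarizable (cokernel f) :=
  isGradedPolarizable.prop_of_epi (cokernel.π f) hB

/-- Images of morphisms into graded-polarizable objects are graded-polarizable. [cite: Carlson1980, §2(a)] [cite: Arapura2022, §1] -/
theorem isGradedPolarizable_image {A B : MixedHodgeStructureCat.{u}} (f : A ⟶ B) (hB : isGradedPolarizable B) : isGradedPolarizable (image f) :=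
  isGradedPolarizable.prop_of_mono (image.ι f) hB

/-! ## §2 The full subcategory of graded-polarizable objects and its inclusion into the finite-dimensional one -/

/-- **The full subcategory `MHS^p` of graded-polarizable mixed Hodge structures.** [cite: Arapura2022, §1] [cite: Carlson1980, §2(a)] -/
abbrev GPSubcategory := isGradedPolarizable.{u}.FullSubcategory

/-- **The inclusion `MHS^p ⥤ (finite-dimensional MHS)`** (`isGradedPolarizable ≤ isFinite`, g45-#10). [cite: Arapura2022, §1] -/
abbrev gpToFin : GPSubcategory.{u} ⥤ FinSubcategory.{u} := ObjectProperty.ιOfLE isGradedPolarizable_le_isFinite.{u}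

/-- Unfolding `gpToFin` on objects. [cite: Arapura2022, §1] -/
theorem gpToFin_obj_obj (X : GPSubcategory.{u}) : (gpToFin.obj X).obj = X.obj := rfl

/-- Unfolding `gpToFin` on morphisms. [cite: Arapura2022, §1] -/
theorem gpToFin_map_hom {X Y : GPSubcategory.{u}} (f : X ⟶ Y) : (gpToFin.map f).hom = f.hom := rfl

/-- `gpToFin` is full. [cite: Arapura2022, §1] -/
theorem gpToFin_full : gpToFin.{u}.Full := inferInstance

/-- `gpToFin` is faithful. [cite: Arapura2022, §1] -/
theorem gpToFin_faithful : gpToFin.{u}.Faithful := inferInstance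

/-- The unit `ℚ(0)` as an object of `MHS^p`. [cite: DeligneHodgeII1971, 2.1.15] -/
def gpUnitObj : GPSubcategory.{u} := ⟨unitObj.{u}, isGradedPolarizable_unitObj⟩

/-- `gpToFin` sends the unit to the unit. [cite: DeligneHodgeII1971, 2.1.15] -/
theorem gpToFin_obj_gpUnitObj : gpToFin.obj gpUnitObj.{u} = finUnitObj.{u} := rfl

/-- The Tate object `ℚ(j)` as an object of `MHS^p`. [cite: DeligneHodgeII1971, 2.1.15] -/
def gpTateObj (j : ℤ) : GPSubcategory.{u} := ⟨tateObj.{u} j, isGradedPolarizable_tateObj j⟩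

/-- Unfolding `gpTateObj`. [cite: DeligneHodgeII1971, 2.1.15] -/
theorem gpTateObj_obj (j : ℤ) : (gpTateObj.{u} j).obj = tateObj.{u} j := rfl

/-! ## §3 The induced functors on `MHS^p` -/

/-- **`X ⊗ −` on `MHS^p`.** [cite: DeligneHodgeII1971, 1.1.12 and 2.1.15] [cite: DeligneMilne1982Tannakian, §1 Def. 1.6–(1.7)] -/
def gpTensorLeft (X : GPSubcategory.{u}) : GPSubcategory.{u} ⥤ GPSubcategory.{u} :=
  isGradedPolarizable.lift (gpToFin ⋙ tensorLeft (gpToFin.obj X) ⋙ isFinite.ι) fun Y =>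
    haveI : Module.Finite ℚ X.obj := X.property.finite
    haveI : Module.Finite ℚ (gpToFin.obj X).obj := X.property.finite
    haveI : Module.Finite ℚ Y.obj := Y.property.finite
    haveI : Module.Finite ℚ (gpToFin.obj Y).obj := Y.property.finite
    isGradedPolarizable_tensorObj X.property Y.property

/-- Unfolding `gpTensorLeft` on objects. [cite: DeligneHodgeII1971, 1.1.12] -/
theorem gpTensorLeft_obj_obj (X Y : GPSubcategory.{u}) :
    ((gpTensorLeft X).obj Y).obj =
      haveI : Module.Finite ℚ X.obj := X.property.finite
      haveI : Module.Finite ℚ (gpToFin.obj X).obj := X.property.finite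
      haveI : Module.Finite ℚ Y.obj := Y.property.finite
      haveI : Module.Finite ℚ (gpToFin.obj Y).obj := Y.property.finite
      tensorObj X.obj Y.obj := rfl

/-- Unfolding `gpTensorLeft` on morphisms. [cite: DeligneHodgeII1971, 1.1.12] -/
theorem gpTensorLeft_map_hom (X : GPSubcategory.{u}) {Y Y' : GPSubcategory.{u}} (g : Y ⟶ Y') :
    ((gpTensorLeft X).map g).hom =
      haveI : Module.Finite ℚ X.obj := X.property.finite
      haveI : Module.Finite ℚ (gpToFin.obj X).obj := X.property.finite
      haveI : Module.Finite ℚ Y.obj := Y.property.finite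
      haveI : Module.Finite ℚ (gpToFin.obj Y).obj := Y.property.finite
      haveI : Module.Finite ℚ Y'.obj := Y'.property.finite
      haveI : Module.Finite ℚ (gpToFin.obj Y').obj := Y'.property.finite
      tensorHom (𝟙 X.obj) g.hom := rfl

/-- `gpTensorLeft X` is the restriction of `tensorLeft`: `gpTensorLeft X ⋙ gpToFin ≅ gpToFin ⋙ tensorLeft (gpToFin.obj X)`. [cite: DeligneMilne1982Tannakian, §1 Def. 1.6–(1.7)] -/
def gpTensorLeftCompGpToFinIso (X : GPSubcategory.{u}) : gpTensorLeft X ⋙ gpToFin ≅ gpToFin ⋙ tensorLeft (gpToFin.obj X) :=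
  Iso.refl _

/-- **`− ⊗ X` on `MHS^p`.** [cite: DeligneHodgeII1971, 1.1.12 and 2.1.15] [cite: DeligneMilne1982Tannakian, §1 Def. 1.6–(1.7)] -/
def gpTensorRight (X : GPSubcategory.{u}) : GPSubcategory.{u} ⥤ GPSubcategory.{u} :=
  isGradedPolarizable.lift (gpToFin ⋙ tensorRight (gpToFin.obj X) ⋙ isFinite.ι) fun K =>
    haveI : Module.Finite ℚ X.obj := X.property.finite
    haveI : Module.Finite ℚ (gpToFin.obj X).obj := X.property.finite
    haveI : Module.Finite ℚ K.obj := K.property.finite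
    haveI : Module.Finite ℚ (gpToFin.obj K).obj := K.property.finite
    isGradedPolarizable_tensorObj K.property X.property

/-- Unfolding `gpTensorRight` on objects. [cite: DeligneHodgeII1971, 1.1.12] -/
theorem gpTensorRight_obj_obj (X K : GPSubcategory.{u}) :
    ((gpTensorRight X).obj K).obj =
      haveI : Module.Finite ℚ X.obj := X.property.finite
      haveI : Module.Finite ℚ (gpToFin.obj X).obj := X.property.finite
      haveI : Module.Finite ℚ K.obj := K.property.finite
      haveI : Module.Finite ℚ (gpToFin.obj K).obj := K.property.finite
      tensorObj K.obj X.obj := rfl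

/-- Unfolding `gpTensorRight` on morphisms. [cite: DeligneHodgeII1971, 1.1.12] -/
theorem gpTensorRight_map_hom (X : GPSubcategory.{u}) {K K' : GPSubcategory.{u}} (f : K ⟶ K') :
    ((gpTensorRight X).map f).hom =
      haveI : Module.Finite ℚ X.obj := X.property.finite
      haveI : Module.Finite ℚ (gpToFin.obj X).obj := X.property.finite
      haveI : Module.Finite ℚ K.obj := K.property.finite
      haveI : Module.Finite ℚ (gpToFin.obj K).obj := K.property.finite
      haveI : Module.Finite ℚ K'.obj := K'.property.finite
      haveI : Module.Finite ℚ (gpToFin.obj K').obj := K'.property.finite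
      tensorHom f.hom (𝟙 X.obj) := rfl

/-- `gpTensorRight X ⋙ gpToFin ≅ gpToFin ⋙ tensorRight (gpToFin.obj X)`. [cite: DeligneMilne1982Tannakian, §1 Def. 1.6–(1.7)] -/
def gpTensorRightCompGpToFinIso (X : GPSubcategory.{u}) : gpTensorRight X ⋙ gpToFin ≅ gpToFin ⋙ tensorRight (gpToFin.obj X) :=
  Iso.refl _

/-- **`Hom(X, −)` on `MHS^p`.** [cite: DeligneHodgeII1971, 1.1.12 and 2.1.15] [cite: DeligneMilne1982Tannakian, §1 Def. 1.6–(1.7)] -/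
def gpIhom (X : GPSubcategory.{u}) : GPSubcategory.{u} ⥤ GPSubcategory.{u} :=
  isGradedPolarizable.lift (gpToFin ⋙ ihom (gpToFin.obj X) ⋙ isFinite.ι) fun Y =>
    haveI : Module.Finite ℚ X.obj := X.property.finite
    haveI : Module.Finite ℚ (gpToFin.obj X).obj := X.property.finite
    haveI : Module.Finite ℚ Y.obj := Y.property.finite
    haveI : Module.Finite ℚ (gpToFin.obj Y).obj := Y.property.finite
    isGradedPolarizable_ihomObj X.property Y.property

/-- Unfolding `gpIhom` on objects. [cite: DeligneHodgeII1971, 1.1.12] -/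
theorem gpIhom_obj_obj (X Y : GPSubcategory.{u}) :
    ((gpIhom X).obj Y).obj =
      haveI : Module.Finite ℚ X.obj := X.property.finite
      haveI : Module.Finite ℚ (gpToFin.obj X).obj := X.property.finite
      haveI : Module.Finite ℚ Y.obj := Y.property.finite
      haveI : Module.Finite ℚ (gpToFin.obj Y).obj := Y.property.finite
      ihomObj X.obj Y.obj := rfl

/-- Unfolding `gpIhom` on morphisms. [cite: DeligneHodgeII1971, 1.1.12] -/
theorem gpIhom_map_hom (X : GPSubcategory.{u}) {Y Y' : GPSubcategory.{u}} (g : Y ⟶ Y') :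
    ((gpIhom X).map g).hom =
      haveI : Module.Finite ℚ X.obj := X.property.finite
      haveI : Module.Finite ℚ (gpToFin.obj X).obj := X.property.finite
      haveI : Module.Finite ℚ Y.obj := Y.property.finite
      haveI : Module.Finite ℚ (gpToFin.obj Y).obj := Y.property.finite
      haveI : Module.Finite ℚ Y'.obj := Y'.property.finite
      haveI : Module.Finite ℚ (gpToFin.obj Y').obj := Y'.property.finite
      ihomMap (𝟙 X.obj) g.hom := rfl

/-- `gpIhom X ⋙ gpToFin ≅ gpToFin ⋙ ihom (gpToFin.obj X)`. [cite: DeligneMilne1982Tannakian, §1 Def. 1.6–(1.7)] -/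
def gpIhomCompGpToFinIso (X : GPSubcategory.{u}) : gpIhom X ⋙ gpToFin ≅ gpToFin ⋙ ihom (gpToFin.obj X) :=
  Iso.refl _

/-- **The duality functor `X ↦ X^∨` on `MHS^p`** (restriction of g45-#10 `dualFunctor`). [cite: CattaniElZeinGriffithsLe2014, Def. 3.1.21 and §3.2.2.7]
[cite: DeligneMilne1982Tannakian, §1 (1.7)] -/
def gpDual : GPSubcategory.{u}ᵒᵖ ⥤ GPSubcategory.{u} :=
  isGradedPolarizable.lift (gpToFin.op ⋙ dualFunctor ⋙ isFinite.ι) fun X =>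
    haveI : Module.Finite ℚ X.unop.obj := X.unop.property.finite
    (isGradedPolarizable_dual_iff (X := X.unop.obj)).2 X.unop.property

/-- Unfolding `gpDual` on objects. [cite: CattaniElZeinGriffithsLe2014, §3.2.2.7] -/
theorem gpDual_obj_obj (X : GPSubcategory.{u}ᵒᵖ) :
    (gpDual.obj X).obj = haveI : Module.Finite ℚ X.unop.obj := X.unop.property.finite; of X.unop.obj.str.dual := rfl

/-- Unfolding `gpDual` on morphisms (the transpose). [cite: CattaniElZeinGriffithsLe2014, §3.2.2.7] -/
theorem gpDual_map_hom {X Y : GPSubcategory.{u}ᵒᵖ} (f : X ⟶ Y) :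
    (gpDual.map f).hom =
      haveI : Module.Finite ℚ X.unop.obj := X.unop.property.finite
      haveI : Module.Finite ℚ Y.unop.obj := Y.unop.property.finite
      transposeHom f.unop.hom := rfl

/-- `gpDual ⋙ gpToFin ≅ gpToFin.op ⋙ dualFunctor`. [cite: DeligneMilne1982Tannakian, §1 (1.7)] -/
def gpDualCompGpToFinIso : gpDual.{u} ⋙ gpToFin ≅ gpToFin.op ⋙ dualFunctor :=
  Iso.refl _

/-- **The Tate twist `(−)(j)` on `MHS^p`.** [cite: DeligneHodgeII1971, 2.1.15] [cite: Carlson1980, §2(a)] -/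
def gpTateTwist (j : ℤ) : GPSubcategory.{u} ⥤ GPSubcategory.{u} :=
  isGradedPolarizable.lift (isGradedPolarizable.ι ⋙ tateTwist j) fun X =>
    haveI : Module.Finite ℚ X.obj := X.property.finite
    haveI : Module.Finite ℚ (gpToFin.obj X).obj := X.property.finite
    (isGradedPolarizable_tateTwist_obj_iff X.obj j).2 X.property

/-- Unfolding `gpTateTwist` on objects. [cite: DeligneHodgeII1971, 2.1.15] -/
theorem gpTateTwist_obj_obj (j : ℤ) (X : GPSubcategory.{u}) : ((gpTateTwist j).obj X).obj = (tateTwist j).obj X.obj := rfl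

/-- Unfolding `gpTateTwist` on morphisms. [cite: DeligneHodgeII1971, 2.1.15] -/
theorem gpTateTwist_map_hom (j : ℤ) {X Y : GPSubcategory.{u}} (f : X ⟶ Y) : ((gpTateTwist j).map f).hom = (tateTwist j).map f.hom := rfl

/-- `gpTateTwist j ⋙ ι ≅ ι ⋙ tateTwist j`. [cite: DeligneHodgeII1971, 2.1.15] -/
def gpTateTwistCompιIso (j : ℤ) : gpTateTwist.{u} j ⋙ isGradedPolarizable.ι ≅ isGradedPolarizable.ι ⋙ tateTwist j := Iso.refl _

/-! ## §4 The adjunction `− ⊗ X ⊣ Hom(X, −)` on `MHS^p` -/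

/-- Currying on `MHS^p`: `Hom(K ⊗ X, Y) ≃ Hom(K, Hom(X, Y))`. [cite: DeligneMilne1982Tannakian, §1 Def. 1.6 and (1.6.3)] [cite: DeligneHodgeII1971, 1.1.12] -/
def gpCurryEquiv (K X Y : GPSubcategory.{u}) : ((gpTensorRight X).obj K ⟶ Y) ≃ (K ⟶ (gpIhom X).obj Y) :=
  haveI : Module.Finite ℚ K.obj := K.property.finite
  haveI : Module.Finite ℚ (gpToFin.obj K).obj := K.property.finite
  haveI : Module.Finite ℚ X.obj := X.property.finite
  haveI : Module.Finite ℚ (gpToFin.obj X).obj := X.property.finite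
  haveI : Module.Finite ℚ Y.obj := Y.property.finite
  haveI : Module.Finite ℚ (gpToFin.obj Y).obj := Y.property.finite
  { toFun := fun g => ObjectProperty.homMk (curry g.hom)
    invFun := fun f => ObjectProperty.homMk (uncurry f.hom)
    left_inv := fun g => isGradedPolarizable.hom_ext (uncurry_curry g.hom)
    right_inv := fun f => isGradedPolarizable.hom_ext (curry_uncurry f.hom) }

/-- Unfolding `gpCurryEquiv`. [cite: DeligneMilne1982Tannakian, §1 Def. 1.6] -/
theorem gpCurryEquiv_apply_hom (K X Y : GPSubcategory.{u}) (g : (gpTensorRight X).obj K ⟶ Y) :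
    (gpCurryEquiv K X Y g).hom =
      haveI : Module.Finite ℚ K.obj := K.property.finite
      haveI : Module.Finite ℚ (gpToFin.obj K).obj := K.property.finite
      haveI : Module.Finite ℚ X.obj := X.property.finite
      haveI : Module.Finite ℚ (gpToFin.obj X).obj := X.property.finite
      haveI : Module.Finite ℚ Y.obj := Y.property.finite
      haveI : Module.Finite ℚ (gpToFin.obj Y).obj := Y.property.finite
      curry g.hom := rfl

/-- **The tensor–Hom adjunction `− ⊗ X ⊣ Hom(X, −)` on `MHS^p`.** [cite: DeligneMilne1982Tannakian, §1 Def. 1.6 and (1.6.3)] [cite: DeligneHodgeII1971, 1.1.12] -/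
def gpTensorIhomAdj (X : GPSubcategory.{u}) : gpTensorRight X ⊣ gpIhom X :=
  Adjunction.mkOfHomEquiv
    { homEquiv := fun K Y => gpCurryEquiv K X Y
      homEquiv_naturality_left_symm := fun {K' K Y} f g => by
        apply isGradedPolarizable.hom_ext
        haveI : Module.Finite ℚ K.obj := K.property.finite
        haveI : Module.Finite ℚ (gpToFin.obj K).obj := K.property.finite
        haveI : Module.Finite ℚ K'.obj := K'.property.finite
        haveI : Module.Finite ℚ (gpToFin.obj K').obj := K'.property.finite
        haveI : Module.Finite ℚ X.obj := X.property.finite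
        haveI : Module.Finite ℚ (gpToFin.obj X).obj := X.property.finite
        haveI : Module.Finite ℚ Y.obj := Y.property.finite
        haveI : Module.Finite ℚ (gpToFin.obj Y).obj := Y.property.finite
        change uncurry (f.hom ≫ g.hom) = tensorHom f.hom (𝟙 X.obj) ≫ uncurry g.hom
        exact uncurry_comp f.hom g.hom
      homEquiv_naturality_right := fun {K Y Y'} f g => by
        apply isGradedPolarizable.hom_ext
        haveI : Module.Finite ℚ K.obj := K.property.finite
        haveI : Module.Finite ℚ (gpToFin.obj K).obj := K.property.finite
        haveI : Module.Finite ℚ X.obj := X.property.finite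
        haveI : Module.Finite ℚ (gpToFin.obj X).obj := X.property.finite
        haveI : Module.Finite ℚ Y.obj := Y.property.finite
        haveI : Module.Finite ℚ (gpToFin.obj Y).obj := Y.property.finite
        haveI : Module.Finite ℚ Y'.obj := Y'.property.finite
        haveI : Module.Finite ℚ (gpToFin.obj Y').obj := Y'.property.finite
        change curry (f.hom ≫ g.hom) = curry f.hom ≫ ihomMap (𝟙 X.obj) g.hom
        exact curry_comp f.hom g.hom }

/-- The hom-set bijection of `gpTensorIhomAdj X` is currying. [cite: DeligneMilne1982Tannakian, §1 Def. 1.6] -/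
theorem gpTensorIhomAdj_homEquiv (X K Y : GPSubcategory.{u}) : (gpTensorIhomAdj X).homEquiv K Y = gpCurryEquiv K X Y := by
  rw [gpTensorIhomAdj, Adjunction.mkOfHomEquiv_homEquiv]

/-- `Hom(X, −)` on `MHS^p` is a right adjoint. [cite: DeligneMilne1982Tannakian, §1 Def. 1.6] -/
theorem gpIhom_isRightAdjoint (X : GPSubcategory.{u}) : (gpIhom X).IsRightAdjoint := ⟨_, ⟨gpTensorIhomAdj X⟩⟩

/-- `− ⊗ X` on `MHS^p` is a left adjoint. [cite: DeligneMilne1982Tannakian, §1 Def. 1.6] -/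
theorem gpTensorRight_isLeftAdjoint (X : GPSubcategory.{u}) : (gpTensorRight X).IsLeftAdjoint := ⟨_, ⟨gpTensorIhomAdj X⟩⟩

end MixedHodgeStructureCat

end Literature.AlgebraicGeometry.Motives
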